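import Mathlib.NumberTheory.Padics.HeightOneSpectrum
import Mathlib.Algebra.Module.Equiv.Basic
import Mathlib.Data.Matrix.Mul
import Literature.NumberTheory.Automorphic.JordanZassenhaus
import HarnessLib

/-!
# Brandt matrices of a quaternion order and the definite congruence number `ξ`

Requested by route `ABC/DefiniteXi` (items `stmt-ABC-2021/2022/2023`, definition item
`defn-brandtXi`): the integer

  `brandtXi N⁺ N⁻ λ = Σ_i w_i φ_i²`,

where, in the Brandt module `ℤ[Cls O]` of an Eichler order `O` of level `N⁺` in the definite
quaternion algebra over `ℚ` of discriminant `N⁻`, `φ` is a generator of the common eigen-line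
`L(λ) = {v : T(p) v = λ(p) v for all primes p ∤ N⁺N⁻}` of the Brandt matrices (when that
lattice has rank one; otherwise the junk value `0`) and `w_i = |O_L(I_i)ˣ| / 2`.  This is the
number `ξ_f(N⁺, N⁻) = ⟨g_f, g_f⟩` of Pollack–Weston (Compos. Math. 147 (2011), §2.1: `M^f ⊆ M`
free of rank one with generator `g_f`, `⟨·,·⟩` the pairing under which the Hecke action is
adjoint), going back to Gross, *Heights and the special values of L-series* (1987), §§1–4
(`⟨e_i, e_j⟩ = w_i δ_ij` on `ℤ[Cls O] = Pic` of the definite Shimura curve).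

## Contents (namespace `Literature.NumberTheory.Automorphic.Brandt`, then `brandtXi`)

* Abstract layer, for any finite index type `ι`, weights `w : ι → ℕ` and matrices
  `T : ℕ → Matrix ι ι ℤ`: the eigen-lattice `eigenLattice N T λ ⊆ ℤ^ι` (a saturated
  `ℤ`-submodule, `mem_eigenLattice_of_smul_mem`), `xi w L = Σ_i w_i |φ_i|²` for `L = ℤ ∙ φ`,
  `φ ≠ 0` (well defined: generators agree up to sign, `eq_or_eq_neg_of_span_eq`, `xi_eq_sum`),
  `0` if `L` is not a line; **transport**: isomorphic data (reindexing along `e : ι ≃ κ`) give the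
  same eigen-lattice and the same `ξ` (`eigenLattice_reindex`, `xi_map_funCongrLeft`,
  `xi_eigenLattice_reindex`).
* Classical Brandt-module data of a `ℤ`-order `O` in a ring `D` (Voight, *Quaternion algebras*,
  GTM 288, chs. 16–17, 23, 41; Pizer, J. Algebra 64 (1980); Eichler): left/right orders of a
  lattice, `IsOrder`, `IsMaximalOrder`, `IsEichlerOrder O N` (intersection of two maximal orders
  with index `N`, Voight Def. 23.4.1 and 23.4.12/23.4.19), invertible lattices (Def. 16.5.1),
  the right class set `ClassSet O = Cls_R O` (Def. 17.3.4: invertible right fractional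
  `O`-ideals with right order `O`, modulo `I ∼ αI`, `α ∈ Dˣ` — the convention of
  `JordanZassenhaus.HasFiniteClassSet`), its **finiteness** for orders in quaternion algebras
  over number fields (`finite_classSet`, from the tree's Jordan–Zassenhaus theorem), the Brandt
  matrices `Brandt.matrix O n` (Voight (41.1.1):
  `T(n)_ij = #{J ⊆ I_j : [I_j : J] = n², [J] = [I_i]}`, a finite count, `finite_brandtSet`) and
  the weights `Brandt.weight O [I] = |O_L(I)ˣ| / 2` (Voight 41.1.3; Gross 1987 §1).
* `Brandt.XiSetup N⁺ N⁻`: a definite quaternion algebra `D` over `ℚ` (tree: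
  `IsQuaternionAlgebra`, `IsTotallyDefinite`, `ramifiedPlaces`, finite places of `ℚ` identified
  with primes by Mathlib's `Rat.HeightOneSpectrum.primesEquiv`) ramified exactly at the primes
  dividing the squarefree `N⁻`, with an Eichler order of level `N⁺`; `XiSetup.xi`;
  `brandtXi N⁺ N⁻ λ` := the value on a chosen setup (`Classical.choice`), `0` if there is none
  (`N⁻` not squarefree, `ω(N⁻)` even, `N⁺ = 0`, `gcd(N⁺, N⁻) ≠ 1`, …), with
  `brandtXi_eq_xi`, `brandtXi_le_of_forall`, `le_brandtXi_of_forall`.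

## Conventions and design

* Hecke action.  With `e_c` (`c ∈ Cls O`) the basis of `ℤ[Cls O]` and
  `t_n e_[I] = Σ_{J ⊆ I, [I:J] = n²} e_[J]`, the coordinate vector `x` of `Σ_c x_c e_c` is moved
  to `T(n) *ᵥ x` (`Matrix.mulVec` of Voight's `T(n)`); this operator is the one that is
  self-adjoint for `⟨x, y⟩ = Σ_i w_i x_i y_i` (`w_i T_ij = w_j T_ji`, Voight 41.1, checked on
  Ex. 41.1.2), i.e. Gross's `t_m` with Gross's pairing; its transpose is not.  Hence
  `eigenLattice` is defined with `mulVec`, and `ξ = Σ w_i φ_i²` is Gross's `⟨φ, φ⟩`.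
* Level.  For `O = O₁ ∩ O₂` Eichler in `D` of discriminant `N⁻`, `[O₁ : O] = [O₂ : O]` is the
  level: locally `[M₂(ℤ_p) : (ℤ_p ℤ_p; p^e ℤ_p ℤ_p)] = p^e` (Voight 23.4.12) and `O_p` is maximal
  at `p ∣ N⁻` (23.4.19).  We therefore *define* "Eichler of level `N`" by the index, avoiding
  completions; `gcd(N⁺, N⁻) = 1` is automatic.
* Choices.  `brandtXi` is the value on *one* setup chosen by `Classical.choice`.  That all setups
  give the same value is the classical independence of the Brandt module from the choice of the
  algebra (unique up to isomorphism, Vignéras III Thm. 3.1 = tree fact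
  `nonempty_algEquiv_of_ramifiedPlaces_eq`), of the Eichler order within its genus (connected
  orders have isomorphic class sets and Brandt matrices, Voight 17.4 and 41.2; Pizer 1980 §2) and
  of representatives; the formal (transport) half is proved here (`xi_eigenLattice_reindex`),
  the arithmetic half is NOT vendored as a fact (D-0026); users needing only bounds use
  `brandtXi_le_of_forall` / `le_brandtXi_of_forall`, which quantify over all setups.
* Junk values (documented at each definition): `xi = 0` off rank one; `Set.ncard`/`Nat.card`
  give `0` on infinite sets (which does not happen here: `finite_brandtSet`, and unit groups of
  orders in definite quaternion algebras are finite — the latter is neither needed nor claimed);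
  `brandtXi = 0` without a setup.

## What is NOT here

The Jacquet–Langlands/Eichler comparison `ℤ[Cls O] ⊗ ℚ ≅ S₂^{N⁻-new}(Γ₀(N⁺N⁻)) ⊕ (Eisenstein)`
(which makes `L(λ_E)` a line for an elliptic curve `E` of conductor `N⁺N⁻`), Eichler's mass
formula, existence of setups (needs the tree facts `exists_isQuaternionAlgebra_of_even` and an
Eichler order of each level), independence of choices as an equality of numbers, and the adelic
description `Cls O = Dˣ \ D̂ˣ / Ôˣ` (tree: `QuaternionicForm`).  Mathlib searches: no `Brandt`,
`Eichler order` (the tree's `eichlerOrder` is the adelic level subgroup of `GL₂`), maximal order,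
or ideal classes of non-commutative orders; used: `Submodule ℤ D` with pointwise `Dˣ`-action,
`AddSubgroup.relIndex`, `Set.ncard`, `Nat.card`, `Rat.HeightOneSpectrum.primesEquiv`.

## References

* J. Voight, *Quaternion Algebras*, GTM 288 (2021): Def. 10.2.1, 10.2.8, 10.4.1, 16.2.9,
  16.2.11, 16.5.1, 17.3.1, 17.3.4, Main Thm. 17.7.1, Def. 23.4.1, Prop. 23.4.3, 23.4.12, 23.4.19,
  (41.1.1), 41.1.3, §41.1.
* R. Pollack, T. Weston, *On anticyclotomic μ-invariants of modular forms*, Compos. Math. 147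
  (2011), §2.1 (`ξ_f(N⁺,N⁻) = ⟨g_f, g_f⟩`).
* B. H. Gross, *Heights and the special values of L-series*, CMS Conf. Proc. 7 (1987), §§1–4.
* A. Pizer, *An algorithm for computing modular forms on Γ₀(N)*, J. Algebra 64 (1980), §2.
-/

noncomputable section

open scoped Pointwise Matrix
open NumberField IsDedekindDomain

universe u

namespace Literature.NumberTheory.Automorphic

namespace Brandt

/-! ### Abstract layer: eigen-lines of commuting integer matrices and `ξ = Σ w_i φ_i²` -/

section Abstract

variable {ι : Type*} [Fintype ι]

/-- The **common eigen-lattice** of the matrices `T p` (`p` prime, `p ∤ N`) for the eigenvalue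
system `λ`: `L(λ) = {v ∈ ℤ^ι : T(p) v = λ(p) v for all primes p ∤ N}`, a `ℤ`-submodule of `ℤ^ι`
(the module `M^f` of Pollack–Weston 2011 §2.1, over `ℤ` instead of `𝒪`). [cite: PollackWeston2011, §2.1] -/
def eigenLattice (N : ℕ) (T : ℕ → Matrix ι ι ℤ) (lam : ℕ → ℤ) : Submodule ℤ (ι → ℤ) where
  carrier := {v | ∀ p : ℕ, p.Prime → ¬ p ∣ N → (T p) *ᵥ v = lam p • v}
  add_mem' {v v'} hv hv' p hp hpN := by
    rw [Matrix.mulVec_add, hv p hp hpN, hv' p hp hpN, smul_add]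
  zero_mem' p hp hpN := by rw [Matrix.mulVec_zero, smul_zero]
  smul_mem' c {v} hv p hp hpN := by
    rw [Matrix.mulVec_smul, hv p hp hpN, smul_comm]

/-- Membership in the eigen-lattice (definitional). [folklore] -/
theorem mem_eigenLattice_iff {N : ℕ} {T : ℕ → Matrix ι ι ℤ} {lam : ℕ → ℤ} {v : ι → ℤ} :
    v ∈ eigenLattice N T lam ↔ ∀ p : ℕ, p.Prime → ¬ p ∣ N → (T p) *ᵥ v = lam p • v :=
  Iff.rfl

/-- The eigen-lattice is saturated in `ℤ^ι`: `c v ∈ L(λ)`, `c ≠ 0` implies `v ∈ L(λ)`; so a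
generator of a rank-one eigen-lattice is a primitive vector. [folklore] -/
theorem mem_eigenLattice_of_smul_mem {N : ℕ} {T : ℕ → Matrix ι ι ℤ} {lam : ℕ → ℤ}
    {v : ι → ℤ} {c : ℤ} (hc : c ≠ 0) (h : c • v ∈ eigenLattice N T lam) :
    v ∈ eigenLattice N T lam := fun p hp hpN => by
  have h' := h p hp hpN
  rw [Matrix.mulVec_smul, smul_comm] at h'
  exact smul_right_injective _ hc h'

omit [Fintype ι] in
/-- Two generators of the same line in `ℤ^ι` agree up to sign. [folklore] -/
theorem eq_or_eq_neg_of_span_eq {φ ψ : ι → ℤ} (hφ : φ ≠ 0)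
    (h : (ℤ ∙ φ : Submodule ℤ (ι → ℤ)) = ℤ ∙ ψ) : ψ = φ ∨ ψ = -φ := by
  have hψ : ψ ∈ (ℤ ∙ φ : Submodule ℤ (ι → ℤ)) := h ▸ Submodule.mem_span_singleton_self ψ
  have hφ' : φ ∈ (ℤ ∙ ψ : Submodule ℤ (ι → ℤ)) := h.symm ▸ Submodule.mem_span_singleton_self φ
  obtain ⟨a, rfl⟩ := Submodule.mem_span_singleton.mp hψ
  obtain ⟨b, hb⟩ := Submodule.mem_span_singleton.mp hφ'
  rw [smul_smul] at hb
  have hba : b * a = 1 := by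
    have h1 : (b * a - 1) • φ = 0 := by rw [sub_smul, one_smul, hb, sub_self]
    exact sub_eq_zero.mp ((smul_eq_zero.mp h1).resolve_right hφ)
  rcases Int.eq_one_or_neg_one_of_mul_eq_one' hba with ⟨-, ha⟩ | ⟨-, ha⟩
  · exact Or.inl (by rw [ha, one_smul])
  · exact Or.inr (by rw [ha, neg_smul, one_smul])

/-- **`ξ` of a lattice**: if `L = ℤ ∙ φ` with `φ ≠ 0` (a line), then
`ξ = ⟨φ, φ⟩ = Σ_i w_i φ_i²` for the pairing `⟨e_i, e_j⟩ = w_i δ_ij` (Gross 1987 §§3–4;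
Pollack–Weston 2011 §2.1, `ξ_f = ⟨g_f, g_f⟩`); independent of the generator (`xi_eq_sum`).
Junk value `0` when `L` is not a line (rank `≠ 1`). Valued in `ℕ` via `Int.natAbs`. [cite: PollackWeston2011, §2.1] -/
def xi (w : ι → ℕ) (L : Submodule ℤ (ι → ℤ)) : ℕ :=
  open scoped Classical in
  if h : ∃ φ : ι → ℤ, φ ≠ 0 ∧ L = ℤ ∙ φ then ∑ i, w i * (h.choose i).natAbs ^ 2 else 0

/-- `ξ` computed with *any* generator of the line: `xi w (ℤ φ) = Σ_i w_i |φ_i|²`. [folklore] -/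
theorem xi_eq_sum (w : ι → ℕ) {L : Submodule ℤ (ι → ℤ)} {φ : ι → ℤ} (hφ : φ ≠ 0)
    (hL : L = ℤ ∙ φ) : xi w L = ∑ i, w i * (φ i).natAbs ^ 2 := by
  have h : ∃ φ : ι → ℤ, φ ≠ 0 ∧ L = ℤ ∙ φ := ⟨φ, hφ, hL⟩
  rw [xi, dif_pos h]
  have key : h.choose = φ ∨ h.choose = -φ :=
    eq_or_eq_neg_of_span_eq hφ (hL.symm.trans h.choose_spec.2)
  refine Finset.sum_congr rfl fun i _ => ?_
  rcases key with hk | hk <;> simp [hk]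

/-- Off rank one, `ξ` is the junk value `0`. [folklore] -/
theorem xi_of_not_isLine (w : ι → ℕ) {L : Submodule ℤ (ι → ℤ)}
    (h : ¬ ∃ φ : ι → ℤ, φ ≠ 0 ∧ L = ℤ ∙ φ) : xi w L = 0 := by
  rw [xi, dif_neg h]

/-! #### Transport: isomorphic Brandt data give the same `ξ` -/

variable {κ : Type*} [Fintype κ]

/-- `ξ` is invariant under the isomorphism `ℤ^ι ≃ ℤ^κ`, `v ↦ v ∘ e⁻¹` induced by a bijection
`e : ι ≃ κ` of index sets, the weights being transported along `e`. [folklore] -/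
theorem xi_map_funCongrLeft (e : ι ≃ κ) (w : ι → ℕ) (L : Submodule ℤ (ι → ℤ)) :
    xi (w ∘ e.symm) (L.map (LinearEquiv.funCongrLeft ℤ ℤ e.symm).toLinearMap) = xi w L := by
  set Φ := LinearEquiv.funCongrLeft ℤ ℤ e.symm with hΦ
  by_cases h : ∃ φ : ι → ℤ, φ ≠ 0 ∧ L = ℤ ∙ φ
  · obtain ⟨φ, hφ, rfl⟩ := h
    have hΦφ : Φ φ ≠ 0 := fun h0 => hφ (Φ.map_eq_zero_iff.mp h0)
    have hmap : (ℤ ∙ φ).map Φ.toLinearMap = ℤ ∙ Φ φ := by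
      rw [Submodule.map_span, Set.image_singleton]; rfl
    rw [xi_eq_sum _ hΦφ hmap, xi_eq_sum _ hφ rfl]
    exact Fintype.sum_equiv e.symm _ _ fun k => by
      simp [hΦ, LinearEquiv.funCongrLeft_apply, LinearMap.funLeft_apply]
  · rw [xi_of_not_isLine _ h, xi_of_not_isLine]
    rintro ⟨ψ, hψ, hL⟩
    refine h ⟨Φ.symm ψ, fun h0 => hψ (Φ.symm.map_eq_zero_iff.mp h0), ?_⟩
    have : L = (L.map Φ.toLinearMap).map Φ.symm.toLinearMap := by
      rw [← Submodule.map_comp]; simp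
    rw [this, hL, Submodule.map_span, Set.image_singleton]; rfl

/-- The eigen-lattice of the reindexed matrices `e T(n) e⁻¹` (`Matrix.reindex e e`) is the image
of the eigen-lattice under `v ↦ v ∘ e⁻¹`. [folklore] -/
theorem eigenLattice_reindex (e : ι ≃ κ) (N : ℕ) (T : ℕ → Matrix ι ι ℤ) (lam : ℕ → ℤ) :
    eigenLattice N (fun n => Matrix.reindex e e (T n)) lam =
      (eigenLattice N T lam).map (LinearEquiv.funCongrLeft ℤ ℤ e.symm).toLinearMap := by
  ext v
  rw [show (LinearEquiv.funCongrLeft ℤ ℤ e.symm).toLinearMap =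
      ↑(LinearEquiv.funCongrLeft ℤ ℤ e.symm) from rfl, Submodule.mem_map_equiv,
    LinearEquiv.funCongrLeft_symm, mem_eigenLattice_iff, mem_eigenLattice_iff]
  refine forall₃_congr fun p _ _ => ?_
  have hv : (LinearEquiv.funCongrLeft ℤ ℤ e.symm.symm) v = v ∘ e := by
    ext i; simp [LinearEquiv.funCongrLeft_apply, LinearMap.funLeft_apply]
  rw [hv, Matrix.reindex_apply, Matrix.submatrix_mulVec_equiv, Equiv.symm_symm]
  constructor
  · intro h
    have := congrArg (fun f => f ∘ e) h
    simp only [Function.comp_assoc, Equiv.symm_comp_self, Function.comp_id] at this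
    rw [this]; rfl
  · intro h
    rw [h]; ext k; simp

/-- **Isomorphic Brandt data give the same `ξ`**: reindexing the Hecke matrices and the weights
along any bijection `e : ι ≃ κ` (in particular: another enumeration of the ideal classes) does
not change `ξ`. This is the formal half of "`ξ` does not depend on the choices". [folklore] -/
theorem xi_eigenLattice_reindex (e : ι ≃ κ) (N : ℕ) (T : ℕ → Matrix ι ι ℤ) (w : ι → ℕ)
    (lam : ℕ → ℤ) :
    xi (w ∘ e.symm) (eigenLattice N (fun n => Matrix.reindex e e (T n)) lam) =
      xi w (eigenLattice N T lam) := by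
  rw [eigenLattice_reindex, xi_map_funCongrLeft]

end Abstract

/-! ### Orders, Eichler orders, ideal classes (Voight chs. 16, 17, 23) -/

section Orders

variable {D : Type u} [Ring D]

/-- The **left order** `O_L(I) = {x ∈ D : x I ⊆ I}` of a `ℤ`-lattice `I ⊆ D`, as a
`ℤ`-submodule (it contains `1` and is multiplicatively closed: `one_mem_leftOrder`,
`mul_mem_leftOrder`; Voight Def. 10.2.8). [cite: Voight2021, Def. 10.2.8] -/
def leftOrder (I : Submodule ℤ D) : Submodule ℤ D where
  carrier := {x | ∀ m ∈ I, x * m ∈ I}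
  add_mem' {a b} ha hb m hm := by rw [add_mul]; exact I.add_mem (ha m hm) (hb m hm)
  zero_mem' m hm := by rw [zero_mul]; exact I.zero_mem
  smul_mem' n {a} ha m hm := by rw [smul_mul_assoc]; exact I.smul_mem n (ha m hm)

/-- The **right order** `O_R(I) = {x ∈ D : I x ⊆ I}` of a `ℤ`-lattice `I ⊆ D` (Voight
Def. 10.2.8; cf. the tree's `rightOrder K D`, the right order of one specific global lattice). [cite: Voight2021, Def. 10.2.8] -/
def rightOrder (I : Submodule ℤ D) : Submodule ℤ D where
  carrier := {x | ∀ m ∈ I, m * x ∈ I}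
  add_mem' {a b} ha hb m hm := by rw [mul_add]; exact I.add_mem (ha m hm) (hb m hm)
  zero_mem' m hm := by rw [mul_zero]; exact I.zero_mem
  smul_mem' n {a} ha m hm := by rw [mul_smul_comm]; exact I.smul_mem n (ha m hm)

/-- `x ∈ O_L(I) ↔ x I ⊆ I` (definitional). [folklore] -/
theorem mem_leftOrder_iff {I : Submodule ℤ D} {x : D} :
    x ∈ leftOrder I ↔ ∀ m ∈ I, x * m ∈ I := Iff.rfl

/-- `x ∈ O_R(I) ↔ I x ⊆ I` (definitional). [folklore] -/
theorem mem_rightOrder_iff {I : Submodule ℤ D} {x : D} :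
    x ∈ rightOrder I ↔ ∀ m ∈ I, m * x ∈ I := Iff.rfl

/-- `1 ∈ O_L(I)`. [folklore] -/
theorem one_mem_leftOrder (I : Submodule ℤ D) : (1 : D) ∈ leftOrder I :=
  fun m hm => by rwa [one_mul]

/-- `O_L(I)` is closed under multiplication. [folklore] -/
theorem mul_mem_leftOrder {I : Submodule ℤ D} {a b : D} (ha : a ∈ leftOrder I)
    (hb : b ∈ leftOrder I) : a * b ∈ leftOrder I :=
  fun m hm => by rw [mul_assoc]; exact ha _ (hb m hm)

/-- `1 ∈ O_R(I)`. [folklore] -/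
theorem one_mem_rightOrder (I : Submodule ℤ D) : (1 : D) ∈ rightOrder I :=
  fun m hm => by rwa [mul_one]

/-- `O_R(I)` is closed under multiplication. [folklore] -/
theorem mul_mem_rightOrder {I : Submodule ℤ D} {a b : D} (ha : a ∈ rightOrder I)
    (hb : b ∈ rightOrder I) : a * b ∈ rightOrder I :=
  fun m hm => by rw [← mul_assoc]; exact hb _ (ha m hm)

variable (D) in
/-- A **`ℤ`-order** in the ring `D`: a full `ℤ`-lattice (`IsFullLattice`, i.e. finitely
generated with `ℚ O = D`) containing `1` and closed under multiplication (Voight Def. 10.2.1 with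
`R = ℤ`; the hypotheses `h1, hmul, hΛ` of the tree's `hasFiniteClassSet_of_isQuaternionAlgebra`,
bundled). [cite: Voight2021, Def. 10.2.1] -/
structure IsOrder (O : Submodule ℤ D) : Prop where
  /-- `1 ∈ O`. -/
  one_mem : (1 : D) ∈ O
  /-- `O O ⊆ O`. -/
  mul_mem : ∀ a ∈ O, ∀ b ∈ O, a * b ∈ O
  /-- `O` is a full `ℤ`-lattice in `D`. -/
  isFullLattice : IsFullLattice D O

variable (D) in
/-- A **maximal order**: an order not properly contained in another order
(Voight Def. 10.4.1). [cite: Voight2021, Def. 10.4.1] -/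
def IsMaximalOrder (O : Submodule ℤ D) : Prop :=
  IsOrder D O ∧ ∀ O' : Submodule ℤ D, IsOrder D O' → O ≤ O' → O' = O

variable (D) in
/-- An **Eichler order of level `N`**: `O = O₁ ∩ O₂` for maximal orders `O₁, O₂` (Voight
Def. 23.4.1, Eichler's definition) with `[O₁ : O] = N` (additive index `AddSubgroup.relIndex`).
For `D` a quaternion algebra over `ℚ` of discriminant `N⁻` this index is the level in the sense
of Voight 23.4.19 (`discrd O = N⁻ · N`): locally `O_p` is maximal at `p ∣ N⁻` and conjugate to
`(ℤ_p ℤ_p; p^e ℤ_p ℤ_p)` of index `p^e` in `M₂(ℤ_p) ⊇` it at `p ∤ N⁻` (Prop. 23.4.3, 23.4.12);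
`gcd(N, N⁻) = 1` is automatic, and `N = 0` (infinite index) never occurs. [cite: Voight2021, Def. 23.4.1 and 23.4.12, 23.4.19] -/
def IsEichlerOrder (O : Submodule ℤ D) (N : ℕ) : Prop :=
  ∃ O₁ O₂ : Submodule ℤ D, IsMaximalOrder D O₁ ∧ IsMaximalOrder D O₂ ∧ O = O₁ ⊓ O₂ ∧
    O.toAddSubgroup.relIndex O₁.toAddSubgroup = N

/-- The **unit index** `w(O) = |Oˣ| / 2 = |Oˣ / {±1}|` of a multiplicatively closed lattice `O ∋ 1`
(the weights `w_i` of Gross 1987 §1 and Voight 41.1.3, `w_i = #O_iˣ/{±1}`), with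
`Oˣ = {x ∈ O : ∃ y ∈ O, x y = y x = 1}` counted by `Nat.card`.  For an order in a definite
quaternion algebra `Oˣ` is finite of even order (`±1 ∈ Oˣ`); if it were infinite `Nat.card`
would return the junk value `0`. [cite: Voight2021, 41.1.3] -/
def unitIndex (O : Submodule ℤ D) : ℕ :=
  Nat.card {x : D // x ∈ O ∧ ∃ y ∈ O, x * y = 1 ∧ y * x = 1} / 2

variable (D) in
/-- An **invertible** lattice `I` (Voight Def. 16.5.1, (16.5.2)): there is a full lattice `I'`
with `I I' = O_L(I) = O_R(I')` and `I' I = O_L(I') = O_R(I)` (products of `ℤ`-submodules of the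
ring `D`).  By Voight's Main Thm. 16.6.1 this is the same as locally principal. [cite: Voight2021, Def. 16.5.1] -/
def IsInvertible (I : Submodule ℤ D) : Prop :=
  ∃ I' : Submodule ℤ D, IsFullLattice D I' ∧
    I * I' = leftOrder I ∧ leftOrder I = rightOrder I' ∧
    I' * I = rightOrder I ∧ leftOrder I' = rightOrder I

/-- The invertible **right fractional `O`-ideals** with right order exactly `O` (Voight
Def. 16.2.9, 16.2.11 "sated", 16.5.1): full lattices `I ⊆ D` with `O_R(I) = O`, invertible.
Their classes form `Cls_R O` (Def. 17.3.4). [cite: Voight2021, Def. 16.2.9, 16.2.11 and 17.3.4] -/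
def rightIdeals (O : Submodule ℤ D) : Set (Submodule ℤ D) :=
  {I | IsFullLattice D I ∧ rightOrder I = O ∧ IsInvertible D I}

/-- **Right classes** (Voight Def. 17.3.1): `I ∼_R J` iff `J = α I` for some `α ∈ Dˣ` (left
multiplication by units, the pointwise action `α • I` used in `HasFiniteClassSet`). An
equivalence relation on `rightIdeals O`. [cite: Voight2021, Def. 17.3.1] -/
def rightClassSetoid (O : Submodule ℤ D) : Setoid (rightIdeals O) where
  r I J := ∃ α : Dˣ, (J : Submodule ℤ D) = α • (I : Submodule ℤ D)
  iseqv :=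
    { refl := fun I => ⟨1, (one_smul _ _).symm⟩
      symm := fun {I J} ⟨α, h⟩ => ⟨α⁻¹, by rw [h, inv_smul_smul]⟩
      trans := fun {I J K} ⟨α, h⟩ ⟨β, h'⟩ => ⟨β * α, by rw [h', h, mul_smul]⟩ }

/-- The **(right) class set** `Cls O = Cls_R O` of `O`: invertible right fractional `O`-ideals
with right order `O` modulo `I ∼ α I`, `α ∈ Dˣ` (Voight Def. 17.3.4).  Finite for an order in a
quaternion algebra over a number field (`finite_classSet`). [cite: Voight2021, Def. 17.3.4] -/
def ClassSet (O : Submodule ℤ D) : Type u := Quotient (rightClassSetoid O)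

/-- A representative ideal `I_c` of the class `c ∈ Cls O` (`Quotient.out`; every construction
below is invariant under `I ↦ α I`, cf. Voight 41.1). [folklore] -/
def ClassSet.rep {O : Submodule ℤ D} (c : ClassSet O) : Submodule ℤ D :=
  ((Quotient.out c : rightIdeals O) : Submodule ℤ D)

/-- The representative of a class is one of the right ideals. [folklore] -/
theorem ClassSet.rep_mem {O : Submodule ℤ D} (c : ClassSet O) : c.rep ∈ rightIdeals O :=
  (Quotient.out c : rightIdeals O).2

/-- The class of the representative of `c` is `c`. [folklore] -/
theorem ClassSet.mk_rep {O : Submodule ℤ D} (c : ClassSet O) :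
    (Quotient.mk (rightClassSetoid O) ⟨c.rep, c.rep_mem⟩ : ClassSet O) = c :=
  Quotient.out_eq c

/-- The **`n`-th Brandt matrix** of `O` (Voight (41.1.1); Pizer 1980 §2; Eichler):
`T(n)_ij = #{J ⊆ I_j : [I_j : J] = n² and [J] = [I_i]}`, the number of right ideals of index
`n²` (reduced norm `n · nrd I_j`) inside the representative `I_j` of the class `j` that lie in
the class `i` (such `J = α I_i` are automatically invertible with right order `O`).  The count is
finite (`finite_brandtSet`); it does not depend on the representatives (`J ↦ β J`).  Column sums
are `p + 1` for `n = p ∤ disc O` prime. Acts on `x ∈ ℤ^{Cls O}` by `Matrix.mulVec`, which is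
Gross's Hecke correspondence `t_n` in coordinates and is self-adjoint for `Σ w_i x_i y_i`
(`w_i T_ij = w_j T_ji`, Voight 41.1). [cite: Voight2021, (41.1.1)] -/
def matrix (O : Submodule ℤ D) (n : ℕ) : Matrix (ClassSet O) (ClassSet O) ℤ :=
  Matrix.of fun i j =>
    ({J : Submodule ℤ D | J ≤ j.rep ∧ J.toAddSubgroup.relIndex j.rep.toAddSubgroup = n ^ 2 ∧
        ∃ α : Dˣ, J = α • i.rep}.ncard : ℤ)

/-- The **weight** `w_c = |O_L(I_c)ˣ| / 2` of a class `c = [I_c]`: half the number of units of the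
left order of (any) representative (Voight 41.1.3; Gross 1987 §1, `w_i = |R_iˣ/±1|`; the
self-intersection `⟨e_c, e_c⟩ = w_c` of Gross §3 / Pollack–Weston §2.1). Left orders of
`I` and `α I` are conjugate, so this is a class function. [cite: Voight2021, 41.1.3] -/
def weight (O : Submodule ℤ D) (c : ClassSet O) : ℕ := unitIndex (leftOrder c.rep)

/-! #### Finiteness -/

/-- The set counted by a Brandt-matrix-type entry is finite: sublattices `J ⊆ I` of index `n²`
(`n ≠ 0`, `I` finitely generated, `D` additively torsion-free) contain `n² I`, and the window
`n² I ⊆ J ⊆ I` is finite (`finite_setOf_le_and_smul_mem`). [folklore] -/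
theorem finite_setOf_subideal [IsAddTorsionFree D] {I : Submodule ℤ D} (hI : I.FG) {n : ℕ}
    (hn : n ≠ 0) (P : Submodule ℤ D → Prop) :
    {J : Submodule ℤ D | J ≤ I ∧ J.toAddSubgroup.relIndex I.toAddSubgroup = n ^ 2 ∧ P J}.Finite := by
  refine (finite_setOf_le_and_smul_mem I hI (n := ((n ^ 2 : ℕ) : ℤ))
    (by exact_mod_cast pow_ne_zero 2 hn)).subset ?_
  rintro J ⟨hJI, hidx, -⟩
  refine ⟨hJI, fun x hx => ?_⟩
  have h := AddSubgroup.nsmul_index_mem (J.toAddSubgroup.addSubgroupOf I.toAddSubgroup) ⟨x, hx⟩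
  rw [AddSubgroup.mem_addSubgroupOf] at h
  rw [AddSubgroup.relIndex] at hidx
  rw [hidx] at h
  rw [natCast_zsmul]
  exact h

/-- The Brandt matrix entry `T(n)_ij`, `n ≠ 0`, counts a finite set (so `Set.ncard` is an honest
cardinality), for `D` additively torsion-free (e.g. an algebra over a field of characteristic
zero, `isAddTorsionFree_of_charZero_module`). [folklore] -/
theorem finite_brandtSet [IsAddTorsionFree D] {O : Submodule ℤ D} (i j : ClassSet O) {n : ℕ}
    (hn : n ≠ 0) :
    {J : Submodule ℤ D | J ≤ j.rep ∧ J.toAddSubgroup.relIndex j.rep.toAddSubgroup = n ^ 2 ∧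
        ∃ α : Dˣ, J = α • i.rep}.Finite :=
  finite_setOf_subideal j.rep_mem.1.1 hn _

/-- From the Jordan–Zassenhaus property `HasFiniteClassSet D O` (finitely many `Dˣ`-orbits of
full right `O`-lattices) the class set `Cls O` is finite: `[I] ↦ d_I • I ∈ T` is injective on
classes. [cite: SwanEvans1970, Ch. 3, Thm. 3.9] -/
theorem finite_classSet_of_hasFiniteClassSet {O : Submodule ℤ D} (h : HasFiniteClassSet D O) :
    Finite (ClassSet O) := by
  classical
  obtain ⟨T, hT⟩ := h
  have key : ∀ I : rightIdeals O, ∃ d : Dˣ, d • (I : Submodule ℤ D) ∈ T := fun I =>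
    hT I I.2.1 fun m hm a ha => by
      have ha' : a ∈ rightOrder (I : Submodule ℤ D) := by rw [I.2.2.1]; exact ha
      exact ha' m hm
  choose d hd using key
  let f : ClassSet O → T := fun c =>
    ⟨d (Quotient.out c) • ((Quotient.out c : rightIdeals O) : Submodule ℤ D), hd _⟩
  refine Finite.of_injective f fun c c' hcc' => ?_
  have h1 := congrArg Subtype.val hcc'
  simp only [f] at h1
  rw [← Quotient.out_eq c, ← Quotient.out_eq c']
  refine Quotient.sound ⟨(d (Quotient.out c'))⁻¹ * d (Quotient.out c), ?_⟩
  rw [mul_smul, h1, inv_smul_smul]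

/-- **Finiteness of the class number**: the class set of a `ℤ`-order in a quaternion algebra over
a number field is finite (Voight Main Thm. 17.7.1; Vignéras III §5 Thm. 5.4; here from the
tree's sorry-free Jordan–Zassenhaus theorem `hasFiniteClassSet_of_isQuaternionAlgebra`). [cite: Voight2021, Main Thm. 17.7.1] -/
theorem finite_classSet (K : Type) [Field K] [NumberField K] [Algebra K D]
    [IsQuaternionAlgebra K D] {O : Submodule ℤ D} (hO : IsOrder D O) : Finite (ClassSet O) :=
  finite_classSet_of_hasFiniteClassSet
    (hasFiniteClassSet_of_isQuaternionAlgebra K D O hO.one_mem hO.mul_mem hO.isFullLattice)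

/-- The intersection of two orders is an order (fullness: `n₁ n₂ d ∈ O₁ ∩ O₂`; finite generation:
`ℤ` is Noetherian). [folklore] -/
theorem IsOrder.inf {O₁ O₂ : Submodule ℤ D} (h₁ : IsOrder D O₁) (h₂ : IsOrder D O₂) :
    IsOrder D (O₁ ⊓ O₂) where
  one_mem := ⟨h₁.one_mem, h₂.one_mem⟩
  mul_mem a ha b hb := ⟨h₁.mul_mem a ha.1 b hb.1, h₂.mul_mem a ha.2 b hb.2⟩
  isFullLattice := by
    refine ⟨Submodule.FG.of_le h₁.isFullLattice.1 inf_le_left, fun d => ?_⟩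
    obtain ⟨n₁, hn₁, h₁d⟩ := h₁.isFullLattice.2 d
    obtain ⟨n₂, hn₂, h₂d⟩ := h₂.isFullLattice.2 d
    refine ⟨n₂ * n₁, mul_ne_zero hn₂ hn₁, ?_, ?_⟩
    · rw [mul_smul]; exact O₁.smul_mem _ h₁d
    · rw [mul_comm, mul_smul]; exact O₂.smul_mem _ h₂d

/-- An Eichler order is an order. [folklore] -/
theorem IsEichlerOrder.isOrder {O : Submodule ℤ D} {N : ℕ} (h : IsEichlerOrder D O N) :
    IsOrder D O := by
  obtain ⟨O₁, O₂, h₁, h₂, rfl, -⟩ := h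
  exact h₁.1.inf h₂.1

/-! #### `ξ` of an order -/

/-- **`ξ` of the order `O` at level `N`** for the eigenvalue system `λ`: `xi` of the weights
`weight O` and the eigen-lattice of the Brandt matrices `Brandt.matrix O` inside `ℤ^{Cls O}`
(primes `p ∤ N`).  Requires `Cls O` finite (true for orders in quaternion algebras over number
fields, `finite_classSet`); junk value `0` otherwise. [cite: PollackWeston2011, §2.1] -/
def xiOfOrder (O : Submodule ℤ D) (N : ℕ) (lam : ℕ → ℤ) : ℕ :=
  open scoped Classical in
  if h : Finite (ClassSet O) then
    letI : Fintype (ClassSet O) := @Fintype.ofFinite (ClassSet O) h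
    xi (weight O) (eigenLattice N (matrix O) lam)
  else 0

/-- `xiOfOrder` unfolded, for any `Fintype` structure on the (finite) class set. [folklore] -/
theorem xiOfOrder_eq (O : Submodule ℤ D) [Fintype (ClassSet O)] (N : ℕ) (lam : ℕ → ℤ) :
    xiOfOrder O N lam = xi (weight O) (eigenLattice N (matrix O) lam) := by
  have h : Finite (ClassSet O) := Finite.of_fintype _
  rw [xiOfOrder, dif_pos h]
  congr!

end Orders

end Brandt

open Brandt in
/-- A **Brandt setup of level `(N⁺, N⁻)`**: a definite quaternion algebra `D` over `ℚ`
(`IsQuaternionAlgebra`, `IsTotallyDefinite`: ramified at `∞`) ramified at exactly the primes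
dividing the squarefree integer `N⁻` (so `disc D = N⁻`; finite places of `ℚ` are identified with
primes by Mathlib's `Rat.HeightOneSpectrum.primesEquiv`), together with an Eichler order `O` of
level `N⁺` in `D` (Gross 1987 §1 for `N⁻ = p`, `N⁺ = 1`; Pollack–Weston 2011 §2.1; Voight
23.4.19).  Such a setup exists iff `N⁻` is squarefree with an odd number of prime factors,
`N⁺ ≥ 1` and `gcd(N⁺, N⁻) = 1` (Hilbert reciprocity / Vignéras III Thm. 3.1 — not proved here). [cite: PollackWeston2011, §2.1] -/
structure Brandt.XiSetup (Nplus Nminus : ℕ) : Type 1 where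
  /-- The quaternion algebra. -/
  D : Type
  [instRing : Ring D]
  [instAlgebra : Algebra ℚ D]
  [isQuaternionAlgebra : IsQuaternionAlgebra ℚ D]
  /-- `D` is definite (ramified at the infinite place). -/
  isTotallyDefinite : IsTotallyDefinite ℚ D
  /-- `N⁻` is squarefree … -/
  squarefree : Squarefree Nminus
  /-- … and `D` is ramified exactly at the primes dividing `N⁻`: `disc D = N⁻`. -/
  ramifiedPlaces_eq : ramifiedPlaces ℚ D =
    {v | ((Rat.HeightOneSpectrum.primesEquiv v : Nat.Primes) : ℕ) ∣ Nminus}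
  /-- The Eichler order. -/
  O : Submodule ℤ D
  /-- `O` is an Eichler order of level `N⁺`. -/
  isEichlerOrder : IsEichlerOrder D O Nplus

namespace Brandt

variable {Nplus Nminus : ℕ}

/-- The ring structure of the algebra of a setup. [folklore] -/
instance XiSetup.instRingD (S : XiSetup Nplus Nminus) : Ring S.D := S.instRing

/-- The `ℚ`-algebra structure of the algebra of a setup. [folklore] -/
instance XiSetup.instAlgebraD (S : XiSetup Nplus Nminus) : Algebra ℚ S.D := S.instAlgebra

/-- The algebra of a setup is a quaternion algebra over `ℚ`. [folklore] -/
instance XiSetup.isQuaternionAlgebraD (S : XiSetup Nplus Nminus) : IsQuaternionAlgebra ℚ S.D :=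
  S.isQuaternionAlgebra

/-- The class set of the Eichler order of a setup is finite (`finite_classSet`). [folklore] -/
instance XiSetup.instFiniteClassSet (S : XiSetup Nplus Nminus) : Finite (ClassSet S.O) :=
  Brandt.finite_classSet ℚ S.isEichlerOrder.isOrder

/-- **`ξ` of a setup**: `xiOfOrder` of its Eichler order at level `N⁺ N⁻` (Hecke matrices at the
primes `p ∤ N⁺N⁻`). [cite: PollackWeston2011, §2.1] -/
def XiSetup.xi (S : XiSetup Nplus Nminus) (lam : ℕ → ℤ) : ℕ :=
  xiOfOrder S.O (Nplus * Nminus) lam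

end Brandt

/-- **The definite congruence number** `ξ(λ; N⁺, N⁻) = Σ_i w_i φ_i²`: in the Brandt module
`ℤ[Cls O]` of an Eichler order `O` of level `N⁺` in the definite quaternion algebra over `ℚ` of
discriminant `N⁻`, let `L = {v : T(p) v = λ(p) v for all primes p ∤ N⁺N⁻}`; if `L = ℤ φ` is a
line, `ξ = ⟨φ, φ⟩ = Σ_i w_i φ_i²` (`w_i = |O_L(I_i)ˣ|/2`), otherwise `0`.  For `λ = (a_n(E))`,
`E/ℚ` an elliptic curve of conductor `N⁺N⁻`, this is `ξ_f(N⁺, N⁻) = ⟨g_f, g_f⟩` of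
Pollack–Weston 2011 §2.1 (Gross 1987 §§3–4).  The value is taken on a setup chosen by
`Classical.choice` (`brandtXi_eq_xi`; bounds valid for every setup transfer by
`brandtXi_le_of_forall` / `le_brandtXi_of_forall`; isomorphic data give the same value,
`Brandt.xi_eigenLattice_reindex`); junk value `0` if there is no setup of level `(N⁺, N⁻)`. [cite: PollackWeston2011, §2.1] -/
def brandtXi (Nplus Nminus : ℕ) (lam : ℕ → ℤ) : ℕ :=
  open scoped Classical in
  if h : Nonempty (Brandt.XiSetup Nplus Nminus) then (Classical.choice h).xi lam else 0

/-- `brandtXi` is the `ξ` of the chosen setup. [folklore] -/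
theorem brandtXi_eq_xi {Nplus Nminus : ℕ} (h : Nonempty (Brandt.XiSetup Nplus Nminus))
    (lam : ℕ → ℤ) : brandtXi Nplus Nminus lam = (Classical.choice h).xi lam := by
  rw [brandtXi, dif_pos h]

/-- Without a setup of level `(N⁺, N⁻)`, `brandtXi` is the junk value `0`. [folklore] -/
theorem brandtXi_of_isEmpty {Nplus Nminus : ℕ} (h : IsEmpty (Brandt.XiSetup Nplus Nminus))
    (lam : ℕ → ℤ) : brandtXi Nplus Nminus lam = 0 := by
  rw [brandtXi, dif_neg (not_nonempty_iff.mpr h)]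

/-- `brandtXi` is realised by some setup (when one exists). [folklore] -/
theorem exists_brandtXi_eq {Nplus Nminus : ℕ} (h : Nonempty (Brandt.XiSetup Nplus Nminus))
    (lam : ℕ → ℤ) : ∃ S : Brandt.XiSetup Nplus Nminus, brandtXi Nplus Nminus lam = S.xi lam :=
  ⟨_, brandtXi_eq_xi h lam⟩

/-- An upper bound valid for every setup bounds `brandtXi` (the form used by route
`ABC/DefiniteXi`: no independence-of-choices theorem is needed for upper bounds). [folklore] -/
theorem brandtXi_le_of_forall {Nplus Nminus : ℕ} {lam : ℕ → ℤ} {B : ℕ}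
    (h : ∀ S : Brandt.XiSetup Nplus Nminus, S.xi lam ≤ B) : brandtXi Nplus Nminus lam ≤ B := by
  by_cases hne : Nonempty (Brandt.XiSetup Nplus Nminus)
  · rw [brandtXi_eq_xi hne]; exact h _
  · rw [brandtXi_of_isEmpty (not_nonempty_iff.mp hne)]; exact Nat.zero_le _

/-- A lower bound valid for every setup bounds `brandtXi` from below, provided a setup exists. [folklore] -/
theorem le_brandtXi_of_forall {Nplus Nminus : ℕ} {lam : ℕ → ℤ} {B : ℕ}
    (hne : Nonempty (Brandt.XiSetup Nplus Nminus))
    (h : ∀ S : Brandt.XiSetup Nplus Nminus, B ≤ S.xi lam) : B ≤ brandtXi Nplus Nminus lam := by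
  rw [brandtXi_eq_xi hne]; exact h _

end Literature.NumberTheory.Automorphic
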